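import Summits.Ventures.CertifiedQuantumChemistry.Rows.V2RDMDualKernelSliced
import HarnessLib

/-!
# Ventures/CertifiedQuantumChemistry — Certificates/HubbardRingL10U100MomentLiterals1.lean: objective-chunk residual LITERALS (part 1/2) of `hubbardRingL10U100T` for its kernel v2RDM certificates

HONEST FRAMING (verbatim): certified bounds for a stated model Hamiltonian in a stated basis; not a
claim about the real molecule beyond that model.

OFFERED FILE (pub-qchem-rdm = rdm-A, generation 71, 2026-08-26; ZERO compute: no kit job, no solver run — the cell's
certificate of record was converted OFFLINE in exact rational arithmetic by stdlib Python (folder `work/ksdp/`, the converter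
first re-derived byte-for-byte the landed N₂ literals of `Certificates/N2Sto6gRe*Kernel*.lean`), and every number below is
re-derived or checked by the kernel). The typer owns `Summits/…` and decides whether and where it lands.
CHECK EVIDENCE: {CHECK_EVIDENCE}

WHAT THIS FILE IS. Data only: the grouped canonical residuals of the objective chunks `objChunk hubbardRingL10U100TF p` for
p ∈ {0, 1, 2, 3, 4, 5, 6, 7, 8, 9} of the model `hubbardRingL10U100T` (`Hamiltonians/HubbardRingL10U100Tables.lean`), as packed literals (`Rows/V2RDMDualKernelPack.lean`:
coefficients over a common denominator, descriptor codes; ≤ 128 terms per packed numeral) — literal part 1 of 2, behind `hubbardRingL10U100T_objResid`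
(`Certificates/HubbardRingL10U100MomentObjective.lean`, which CHECKS each literal against the model by one `decide +kernel` per chunk).
A wrong literal here cannot prove anything: its only use is that kernel equation.
-/

namespace Summit.Ventures.CertifiedQuantumChemistry.Certificates

/-- Grouped canonical residuals of the objective chunks p ∈ {0, 1, 2, 3, 4, 5, 6, 7, 8, 9} of `hubbardRingL10U100T` (5, 5, 5, 5, 5, 5, 5, 5, 5, 5 monomials), packed; literal part 1/2 (behind `hubbardRingL10U100T_objResid`). -/
def hubbardRingL10U100T_objResidL1 : List (List V2RDMDual.Term) := [
  (V2RDMDual.Pack.terms 256 128 1 5 981391605631 6647763839436105668918108644345643136),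
  (V2RDMDual.Pack.terms 256 128 1 5 981391605631 7322927225589888565363784005994938496),
  (V2RDMDual.Pack.terms 256 128 1 5 981391605631 7998090611782357088183494523484111106),
  (V2RDMDual.Pack.terms 256 128 1 5 981391605631 8673253997974825611003205040973283716),
  (V2RDMDual.Pack.terms 256 128 1 5 981391605631 9348417384167294133822915558462456326),
  (V2RDMDual.Pack.terms 256 128 1 5 981391605631 10023580770359762656642626075951628936),
  (V2RDMDual.Pack.terms 256 128 1 5 981391605631 10698744156552231179462336593440801546),
  (V2RDMDual.Pack.terms 256 128 1 5 981391605631 11373907542744699702282047110929974156),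
  (V2RDMDual.Pack.terms 256 128 1 5 981391605631 12049070928937168225101757628419146766),
  (V2RDMDual.Pack.terms 256 128 1 5 981391605631 12724234315124725486761269312014517376)]

end Summit.Ventures.CertifiedQuantumChemistry.Certificates
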